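import Mathlib.RingTheory.Ideal.Operations
import HarnessLib

/-!
# Two-prime splitting of supported ideals from Ribet's one-prime congruence identity: the ring step "(R) ⟸ (K)" of Proposition V58 (cell `b2b-bsdres`, seat additive-p4 gen 35, line V58/V60 — K107)

HONEST FRAMING (verbatim, cell `b2b-bsdres`): the goal of the cell is to DELETE the COMBINATION-SHAPED
residual classes for ALL analytic-rank `≤ 1` curves over `ℚ` — "full BSD formula for every rank `≤ 1`
curve in class `C`" assembled STRICTLY from published theorems — so that the rank-`≤ 1` remainder
becomes exactly the CONSTRUCTION-SHAPED classes, which are TYPED (missing-input Props), NOT attempted;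
this is not "finishing BSD". This file: PURE ALGEBRA (ideal arithmetic in a commutative ring); no
arithmetic input, no conjecture, nothing booked; 0 defs.

## What is proved

Setting of memo V58 §§1–4 (after REFEREE 2's correction F1): `𝕋′ = 𝕋(N)_{𝔪₂}` a commutative ring,
`N = M₀ℓ₁ℓ₂`; for a set `S` of newform TYPES (`oo, Z, W, W′` according to `ℓ₁ ∣ level`, `ℓ₂ ∣ level`)
`A_S ⊆ 𝕋′` is the ideal of operators SUPPORTED on `S` (vanishing on every component of type `∉ S`), so
`A_S ∩ A_{S′} = A_{S∩S′}` and `S ⊆ S′ ⇒ A_S ⊆ A_{S′}`. The ring identity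

  (R) `A_{oo∪Z∪W} = A_{oo∪Z} + A_{oo∪W}`

("an operator killing the `ℓ₁ℓ₂`-new forms is a sum of one killing all `ℓ₁`-new forms and one killing
all `ℓ₂`-new forms") is, under multiplicity one, equivalent to the two-prime old-space exactness T-V54
(memo V58 §2 step (i)). This file proves the abstract form of the deduction (R) ⟸ (K):

* `supported_le_sup_of_levelRaising` — if `η ∈ A_{oo∪Z}` (for `η = U_{ℓ₁}² − 1`: it kills every
  `ℓ₁`-new component, `a_{ℓ₁} = ±1` there) and (K) every `t ∈ A_{oo∪Z∪W}` satisfies `t − η·a ∈ A_{oo∪W∪W′}`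
  for some `a` (i.e. "`t` restricted to the `Z`-components is `η·a`" — Ribet's congruence identity for
  the definite quaternion algebra `D_{ℓ₂∞}` at `ℓ₁`, `X4/LevelRaisingCongruenceOfOldSupported`), then
  `A_{oo∪Z∪W} ≤ A_{oo∪Z} ⊔ A_{oo∪W}`, using only `A_{oo∪Z} ≤ A_{oo∪Z∪W}` and
  `A_{oo∪Z∪W} ⊓ A_{oo∪W∪W′} ≤ A_{oo∪W}`.
* `supported_sup_eq_of_levelRaising` — with `A_{oo∪W} ≤ A_{oo∪Z∪W}` as well, equality (R).

The four ideals enter as hypotheses with exactly the lattice relations used; nothing here is specific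
to Hecke algebras. The D-side input (K) and the multiplicity-one step (i) are NOT proved here.

## References

* K. A. Ribet, Invent. Math. 100 (1990) 431–476, §3, (6.1) (`η`-congruence identity). [cite: Ribet1990, §3, (6.1)]
* F. Diamond, "The refined conjecture of Serre" (Hong Kong 1993 volume), §§3–4. [cite: Diamond1995RefinedSerre, §§3–4]
-/

namespace Summit.BirchSwinnertonDyer.Rank1Residual.LevelLowering

section SupportedIdeals

variable {T : Type*} [CommRing T]

/-- **(R) ⟸ (K), inclusion form.** Supported ideals `AooZ ≤ AooZW`, `AooZW ⊓ AooWW' ≤ AooW`; if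
`η ∈ AooZ` and every `t ∈ AooZW` is congruent to a multiple of `η` modulo `AooWW'` (Ribet's one-prime
identity (K) on the `ℓ₂`-new quotient), then `AooZW ≤ AooZ ⊔ AooW`. [cite: Ribet1990, §3, (6.1)] -/
theorem supported_le_sup_of_levelRaising (AooZ AooW AooZW AooWW' : Ideal T) (η : T)
    (hZ : AooZ ≤ AooZW) (hinf : AooZW ⊓ AooWW' ≤ AooW) (hη : η ∈ AooZ)
    (hK : ∀ t ∈ AooZW, ∃ a : T, t - η * a ∈ AooWW') :
    AooZW ≤ AooZ ⊔ AooW := by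
  intro t ht
  obtain ⟨a, ha⟩ := hK t ht
  -- `η·a` is supported on `oo ∪ Z`; the remainder `t − η·a` on `(oo∪Z∪W) ∩ (oo∪W∪W′) = oo ∪ W`.
  have hηa : η * a ∈ AooZ := Ideal.mul_mem_right a AooZ hη
  have hrem : t - η * a ∈ AooW := hinf ⟨AooZW.sub_mem ht (hZ hηa), ha⟩
  have : t = η * a + (t - η * a) := by ring
  rw [this]
  exact Submodule.add_mem_sup hηa hrem

/-- **(R) ⟸ (K), equality form:** with both one-prime inclusions `AooZ, AooW ≤ AooZW` the supported
ideal of the three old types is the sum of the two single-prime old-supported ideals.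
[cite: Ribet1990, §3, (6.1)] [cite: Diamond1995RefinedSerre, §§3–4] -/
theorem supported_sup_eq_of_levelRaising (AooZ AooW AooZW AooWW' : Ideal T) (η : T)
    (hZ : AooZ ≤ AooZW) (hW : AooW ≤ AooZW) (hinf : AooZW ⊓ AooWW' ≤ AooW) (hη : η ∈ AooZ)
    (hK : ∀ t ∈ AooZW, ∃ a : T, t - η * a ∈ AooWW') :
    AooZ ⊔ AooW = AooZW :=
  le_antisymm (sup_le hZ hW) (supported_le_sup_of_levelRaising AooZ AooW AooZW AooWW' η hZ hinf hη hK)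

end SupportedIdeals

end Summit.BirchSwinnertonDyer.Rank1Residual.LevelLowering
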